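import Summits.Ventures.KdS.HorizonCertBounds
import Summits.Ventures.KdS.SharpWindows
import HarnessLib

/-!
# Venture KdS — window constants (H4) of a tile from a horizon certificate, by `norm_num`

HONEST FRAMING (venture `Summits/Ventures/KdS`, cell `pub-kds`): ELEMENTARY real analysis / bookkeeping, written so
that the "window constants" hypothesis (H4) of the box theorems can be discharged PER TILE by a finite list of
rational inequalities (`norm_num`). No claim about mode stability is made here.

`windowConstants_of_cert : c.Valid t → c.TableOK t T → WindowConstants t.box T.toTable` (+ the scalar and μ = 0
twins) for a table of the cell's standard shape (`RatTable`: `M0 = 2`, half-widths `R0, R1, R2` for `m = 0`,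
`|m| = 1`, otherwise; height `H`; scalar heights `h1, h2`; μ = 0 squares `SqTable`), PROVIDED finitely many closed
rational inequalities hold (`TableOK`, `ScalarOK`, `SquaresOK` — decidable by `norm_num` per tile). One of them is
`2·omhi ≤ H`: the window must contain Casals–Teixeira da Costa's disc `|ω| < |m|Ω_SR` (used by `statementA_of`).
Sanity instances for the pilot box B0 (`certB0_valid`, `certB0_tableOK`, `windowConstants_tileB0`; the hand proofs are
`HorizonsB0.lean` / `WindowConstantsB0.lean`).
-/

noncomputable section

open Set

namespace Summit.Ventures.KdS

open Literature.Geometry.Lorentzian Literature.Geometry.Lorentzian.KerrDeSitter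

/-! ### Tables of the standard shape -/

/-- A window table with rational entries in the cell's standard shape (`M0 = 2`). -/
structure RatTable where
  /-- half-width for `m = 0` -/
  R0 : ℝ
  /-- half-width for `|m| = 1` -/
  R1 : ℝ
  /-- half-width otherwise (`|m| = 2` and non-integral `m`) -/
  R2 : ℝ
  /-- height of the `s = -2` window -/
  H : ℝ
  /-- scalar (`s = 0`, `μ = 1`) height for `|m| = 1` -/
  h1 : ℝ
  /-- scalar height otherwise -/
  h2 : ℝ

/-- The `WindowTable` of a `RatTable`. -/
def RatTable.toTable (T : RatTable) : WindowTable :=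
  ⟨2, fun m => if m = 0 then T.R0 else if |m| = 1 then T.R1 else T.R2, T.H,
    fun m => if |m| = 1 then T.h1 else T.h2⟩

/-- Square half-sizes for the μ = 0 windows (`m = 0`, `|m| = 1`, otherwise). -/
structure SqTable where
  /-- `m = 0` -/
  S0 : ℝ
  /-- `|m| = 1` -/
  S1 : ℝ
  /-- otherwise -/
  S2 : ℝ

/-- The `R0` function of a `SqTable`. -/
def SqTable.toFun (S : SqTable) : ℝ → ℝ :=
  fun m => if m = 0 then S.S0 else if |m| = 1 then S.S1 else S.S2

/-- The finitely many rational inequalities making `T` an admissible `s = -2` table on the tile. -/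
def HorizonCert.TableOK (c : HorizonCert) (t : Tile) (T : RatTable) : Prop :=
  t.ahi * t.Λhi < 3 ∧ t.ahi ^ 2 * t.Λhi < 3 ∧ 0 < c.omDen t ∧
  c.k1hi t ≤ c.k0lo t ∧ c.k2hi t ≤ T.H ∧ 0 ≤ T.R0 ∧
  c.omhi t ≤ T.R1 ∧ c.w2hi t ≤ T.R1 ∧ 2 * c.omhi t ≤ T.R2 ∧ 2 * c.w2hi t ≤ T.R2 ∧ 2 * c.omhi t ≤ T.H

/-- The extra inequalities for the scalar (`s = 0`, `μ = 1`) heights. -/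
def HorizonCert.ScalarOK (c : HorizonCert) (t : Tile) (T : RatTable) : Prop :=
  0 < c.omDen t ∧ c.omhi t ≤ T.h1 ∧ 2 * c.omhi t ≤ T.h2

/-- The SHARP inequalities for the μ = 0 squares (A40 (ii)): `|m|·w1hi ≤ S_m`, feeding
`WindowConstants0'` / `statementA0_of'` of `SharpWindows.lean`. -/
def HorizonCert.SquaresOK' (c : HorizonCert) (t : Tile) (S : SqTable) : Prop :=
  0 ≤ S.S0 ∧ 0 ≤ S.S1 ∧ 0 ≤ S.S2 ∧ c.w1hi t ≤ S.S1 ∧ 2 * c.w1hi t ≤ S.S2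

/-- The inequalities for the μ = 0 squares: `conf0Sq ≤ S_m²`. -/
def HorizonCert.SquaresOK (c : HorizonCert) (t : Tile) (S : SqTable) : Prop :=
  0 ≤ S.S0 ∧ 0 ≤ S.S1 ∧ 0 ≤ S.S2 ∧ 2 * t.Λhi / 3 ≤ S.S0 ^ 2 ∧
    c.w1hi t ^ 2 + 2 * t.Λhi / 3 ≤ S.S1 ^ 2 ∧ 4 * c.w1hi t ^ 2 + 2 * t.Λhi / 3 ≤ S.S2 ^ 2


/-! ### The window constants from the certificate -/

section Table

variable {c : HorizonCert} {t : Tile} (hv : c.Valid t)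
include hv

/-- **Generic H4.** A valid horizon certificate plus the rational table checks give
`WindowConstants` on the tile for the standard-shape table. -/
theorem windowConstants_of_cert {T : RatTable} (hT : c.TableOK t T) :
    WindowConstants t.box T.toTable := by
  rintro ⟨M, a, Λ⟩ ⟨hM, ha, hΛ⟩
  simp only at hM ha hΛ
  subst hM
  have ha' : t.alo ≤ a ∧ a ≤ t.ahi := ⟨ha.1, ha.2⟩
  have hΛ' : t.Λlo ≤ Λ ∧ Λ ≤ t.Λhi := ⟨hΛ.1, hΛ.2⟩
  obtain ⟨haL, haL2, hden, hk10, hk2H, hR0, hR1a, hR1b, hR2a, hR2b, hH⟩ := hT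
  obtain ⟨hsub, -, -, -, -, -⟩ := horizons_of_cert hv ha' hΛ'
  obtain ⟨hk0, hk0pos⟩ := kappaCauchy_ge_of_cert hv ha' hΛ'
  obtain ⟨hk1, hk1'⟩ := kappaEvent_le_of_cert hv ha' hΛ'
  obtain ⟨hk2, hk2'⟩ := kappaCosmo_le_of_cert hv ha' hΛ'
  obtain ⟨hΩ0, hΩ⟩ := superradiantUpper_le_of_cert hv ha' hΛ' hden
  obtain ⟨hϖ0, hϖ⟩ := varpiCosmo_le_of_cert hv ha' hΛ'
  have ha0 : 0 < t.alo := hv.1.1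
  have hapos : 0 < a := by linarith [ha.1]
  have hΛ0 : 0 < Λ := by linarith [hΛ.1, hv.1.2.2.1]
  have hΛhi : 0 < t.Λhi := by linarith [hΛ.1, hΛ.2, hv.1.2.2.1]
  have h3 : 3 / t.Λhi ≤ 3 / Λ := div_le_div_of_nonneg_left (by norm_num) hΛ0 hΛ.2
  have h3' : t.ahi < 3 / t.Λhi := by rw [lt_div_iff₀ hΛhi]; linarith
  have h3'' : t.ahi ^ 2 < 3 / t.Λhi := by rw [lt_div_iff₀ hΛhi]; linarith
  refine ⟨hsub, hapos, ?_, ?_, ⟨by linarith, hk1, hk2, by linarith⟩, ?_, ?_⟩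
  · rw [abs_of_pos hapos]; linarith [ha.2]
  · have : a ^ 2 ≤ t.ahi ^ 2 := pow_le_pow_left₀ hapos.le ha.2 2
    linarith
  · show surfaceGravity 1 a Λ (rCosmo 1 a Λ) ≤ T.H
    linarith
  · intro m hm
    change |m| ≤ 2 at hm
    show |m| * superradiantUpper 1 a Λ ≤ (if m = 0 then T.R0 else if |m| = 1 then T.R1 else T.R2) ∧
      |m| * superradiantUpper 1 a Λ ≤ T.H ∧
      |m * horizonAngVel a (rCosmo 1 a Λ)| ≤ (if m = 0 then T.R0 else if |m| = 1 then T.R1 else T.R2)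
    have hmabs : 0 ≤ |m| := abs_nonneg m
    have hprod : |m| * superradiantUpper 1 a Λ ≤ 2 * c.omhi t := mul_le_mul hm hΩ hΩ0 (by norm_num)
    have hprod2 : |m * horizonAngVel a (rCosmo 1 a Λ)| ≤ 2 * c.w2hi t := by
      rw [abs_mul, abs_of_nonneg hϖ0]
      exact mul_le_mul hm hϖ hϖ0 (by norm_num)
    refine ⟨?_, by linarith, ?_⟩
    · split_ifs with h0 h1
      · rw [h0]; simpa using hR0
      · rw [h1, one_mul]; linarith
      · linarith
    · split_ifs with h0 h1
      · rw [h0]; simpa using hR0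
      · rw [abs_mul, abs_of_nonneg hϖ0, h1, one_mul]; linarith
      · linarith

/-- **Generic H4s.** The scalar heights. -/
theorem windowConstantsScalar_of_cert {T : RatTable} (hS : c.ScalarOK t T) :
    WindowConstantsScalar t.box T.toTable := by
  rintro ⟨M, a, Λ⟩ ⟨hM, ha, hΛ⟩ m hm hm0
  simp only at hM ha hΛ
  subst hM
  have ha' : t.alo ≤ a ∧ a ≤ t.ahi := ⟨ha.1, ha.2⟩
  have hΛ' : t.Λlo ≤ Λ ∧ Λ ≤ t.Λhi := ⟨hΛ.1, hΛ.2⟩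
  obtain ⟨hden, hh1, hh2⟩ := hS
  obtain ⟨hΩ0, hΩ⟩ := superradiantUpper_le_of_cert hv ha' hΛ' hden
  change |m| ≤ 2 at hm
  show |m| * superradiantUpper 1 a Λ ≤ (if |m| = 1 then T.h1 else T.h2)
  have hprod : |m| * superradiantUpper 1 a Λ ≤ 2 * c.omhi t :=
    mul_le_mul hm hΩ hΩ0 (by norm_num)
  split_ifs with h1
  · rw [h1, one_mul]; linarith
  · linarith

/-- **Generic H4₀.** The μ = 0 squares. -/
theorem windowConstants0_of_cert {S : SqTable} (hS : c.SquaresOK t S) :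
    WindowConstants0 t.box 2 S.toFun := by
  rintro ⟨M, a, Λ⟩ ⟨hM, ha, hΛ⟩ m hm
  simp only at hM ha hΛ
  subst hM
  have ha' : t.alo ≤ a ∧ a ≤ t.ahi := ⟨ha.1, ha.2⟩
  have hΛ' : t.Λlo ≤ Λ ∧ Λ ≤ t.Λhi := ⟨hΛ.1, hΛ.2⟩
  obtain ⟨h0, h1, h2, hs0, hs1, hs2⟩ := hS
  have hc := conf0Sq_le_of_cert hv ha' hΛ' m
  have habs : |m| ≤ 2 := hm
  have hm2 : m ^ 2 ≤ 4 := by nlinarith [abs_le.mp habs, sq_abs m]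
  have hw2 : 0 ≤ c.w1hi t ^ 2 := sq_nonneg _
  show 0 ≤ S.toFun m ∧ conf0Sq 1 a Λ m ≤ S.toFun m ^ 2
  unfold SqTable.toFun
  split_ifs with hm0 hm1
  · subst hm0
    refine ⟨h0, ?_⟩
    simpa using hc.trans (by linarith)
  · have : m ^ 2 = 1 := by nlinarith [sq_abs m, hm1]
    refine ⟨h1, ?_⟩
    rw [this, one_mul] at hc
    linarith
  · refine ⟨h2, hc.trans ?_⟩
    nlinarith

/-- **Generic H4₀′ (sharp).** The μ = 0 squares contain the disc `|ω| < |m|ϖ₁`. -/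
theorem windowConstants0'_of_cert {S : SqTable} (hS : c.SquaresOK' t S) :
    WindowConstants0' t.box 2 S.toFun := by
  rintro ⟨M, a, Λ⟩ ⟨hM, ha, hΛ⟩
  simp only at hM ha hΛ
  subst hM
  have ha' : t.alo ≤ a ∧ a ≤ t.ahi := ⟨ha.1, ha.2⟩
  have hΛ' : t.Λlo ≤ Λ ∧ Λ ≤ t.Λhi := ⟨hΛ.1, hΛ.2⟩
  obtain ⟨h0, h1, h2, hs1, hs2⟩ := hS
  obtain ⟨hsub, -, -, -, -, -⟩ := horizons_of_cert hv ha' hΛ'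
  obtain ⟨hw0, hw1⟩ := varpiEvent_le_of_cert hv ha' hΛ'
  refine ⟨hsub, by linarith [ha.1, hv.1.1], ?_⟩
  intro m hm
  change |m| ≤ 2 at hm
  have hprod : |m| * horizonAngVel a (rPlus 1 a Λ) ≤ 2 * c.w1hi t := mul_le_mul hm hw1 hw0 (by norm_num)
  show 0 ≤ S.toFun m ∧ |m| * horizonAngVel a (rPlus 1 a Λ) ≤ S.toFun m
  unfold SqTable.toFun
  split_ifs with hm0 hm1
  · refine ⟨h0, ?_⟩
    rw [hm0]; simpa using h0
  · refine ⟨h1, ?_⟩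
    rw [hm1, one_mul]; exact hw1.trans hs1
  · exact ⟨h2, hprod.trans hs2⟩

end Table

/-! ### Sanity check on the pilot box B0 (the hand proofs are `HorizonsB0` / `WindowConstantsB0`) -/

/-- B0 as a tile. -/
def tileB0 : Tile := ⟨1 / 2, 251 / 500, 1 / 50, 101 / 5000⟩

/-- The HorizonsB0 brackets as a certificate. -/
def certB0 : HorizonCert := ⟨13 / 100, 17 / 125, 19 / 10, 39 / 20, 54 / 5, 111 / 10⟩

/-- The B0 certificate is valid (40 rational inequalities, `norm_num`). -/
theorem certB0_valid : certB0.Valid tileB0 := by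
  norm_num [HorizonCert.Valid, Tile.AtCorners, certB0, tileB0, dB, dB1, bil]


/-- The final B0 table in the standard shape. -/
def ratTableB0 : RatTable := ⟨1 / 30, 1 / 20, 19 / 200, 3 / 20, 1 / 20, 19 / 200⟩

/-- The B0 μ = 0 squares in the standard shape. -/
def sqTableB0 : SqTable := ⟨3 / 20, 1 / 5, 1 / 3⟩

/-- B0's table passes `TableOK`. -/
theorem certB0_tableOK : certB0.TableOK tileB0 ratTableB0 := by
  norm_num [HorizonCert.TableOK, HorizonCert.k0lo, HorizonCert.k1hi, HorizonCert.k2hi,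
    HorizonCert.omDen, HorizonCert.omhi, HorizonCert.w2hi, HorizonCert.d0max, HorizonCert.d1max,
    HorizonCert.d1min, HorizonCert.d2min, HorizonCert.d2max, Tile.cmax, Tile.cmin, Tile.xiMax,
    max4, min4, certB0, tileB0, ratTableB0, dB1, dB2, bil]

/-- B0's table passes `ScalarOK`. -/
theorem certB0_scalarOK : certB0.ScalarOK tileB0 ratTableB0 := by
  norm_num [HorizonCert.ScalarOK, HorizonCert.omDen, HorizonCert.omhi, certB0, tileB0, ratTableB0]

/-- B0's μ = 0 squares pass the sharp `SquaresOK'`. -/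
theorem certB0_squaresOK' : certB0.SquaresOK' tileB0 sqTableB0 := by
  norm_num [HorizonCert.SquaresOK', HorizonCert.w1hi, certB0, tileB0, sqTableB0]

/-- B0's μ = 0 squares pass `SquaresOK`. -/
theorem certB0_squaresOK : certB0.SquaresOK tileB0 sqTableB0 := by
  norm_num [HorizonCert.SquaresOK, HorizonCert.w1hi, certB0, tileB0, sqTableB0]

/-- B0's window constants for the standard-shape table, by certificate (cf. `windowConstants_B0`). -/
theorem windowConstants_tileB0 : WindowConstants tileB0.box ratTableB0.toTable :=
  windowConstants_of_cert certB0_valid certB0_tableOK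


end Summit.Ventures.KdS

end
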